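import Literature.Computability.QuantumComplexity.GRData
import HarnessLib

/-!
# The initial content of the concrete Grover–Rudolph block: parameters in place, everything else blank

Topic `Literature/Computability/QuantumComplexity`, grouping namespace `GRData`; sequel of `GRData.lean`
(the `GRBlock.Data` of the concrete Grover–Rudolph block of Regev's sampler: kit, point register `ws`,
parameter wires `pw`, and the clean-input condition `Data.P` = kit clean ∧ every level's work window
clean ∧ parameters in place). Regev 2009 (J. ACM 56, art. 34), Lemma 3.12 (proof) with Grover–Rudolph
(2002): the state-preparation block starts on `|0…0⟩` in the point register with the (classically
precomputed) parameters written next to it. Here: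

* `init m` — the label holding the parameter word `m.c` on the parameter wires and `0` everywhere else;
  `init_pw`, `init_ws`, `init_eq_false_of_not_mem_range`;
* **`init_mem_P`** — `init m` satisfies the block's clean-input condition `(data m …).P`;
* `eraseList m E` — for a family of block embeddings `E i`, the wires `E i (pw t)` with `m.c t = 1` (the
  wires a layer of `X` gates must flip to write the parameters into every block from the blank
  register); **`nodup_eraseList`** (for pairwise disjoint blocks) and **`mem_eraseList_iff`** — its
  specification in the form used by the sampler's first stage
  (`w ∈ L ↔ ∃ i q, q ∉ range ws ∧ init q ≠ 0 ∧ E i q = w`).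

Everything is proved; the two definitions have bodies; no named fact is introduced.

## References

* O. Regev, *On lattices, learning with errors, random linear codes, and cryptography*, J. ACM 56
  (2009), art. 34; author's version arXiv:2401.03703, Lemma 3.12 (proof) [Regev2009].
* L. Grover, T. Rudolph, *Creating superpositions that correspond to efficiently integrable probability
  distributions*, arXiv:quant-ph/0208112 (2002), eq. (1)–(4) [GroverRudolph2002].
* M. A. Nielsen, I. L. Chuang, *Quantum Computation and Quantum Information*, CUP 2010, §4.3 (the `X`
  gate on a basis state) [NielsenChuang2010].
-/

noncomputable section

namespace Literature.Computability.QuantumComplexity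

open Cryptography GadgetKit GRWord RevSim RevClean

namespace GRData

variable {ℓ np wlen kk : ℕ} {a : Fin ℓ → (Fin ℓ → Bool) → ℝ} (m : Mach ℓ np wlen kk a) (hk1 : 1 ≤ kk)

/-- **The initial content of the block**: the parameter word on the parameter wires, every other wire
blank. [cite: Regev2009, Lemma 3.12 (proof)] -/
def init : QReg (B ℓ np wlen kk) := fun q =>
  if h : ℓ ≤ (q : ℕ) ∧ (q : ℕ) < ℓ + np then m.c ⟨q - ℓ, by omega⟩ else false

/-- The parameter wires hold the parameter word. [folklore] -/
@[simp] theorem init_pw (t : Fin np) : init m (pw ℓ np wlen kk t) = m.c t := by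
  unfold init
  rw [dif_pos (by rw [pw_val]; omega)]
  congr 1
  exact Fin.ext (by simp only [pw_val]; omega)

/-- Below the parameter wires the content is blank. [folklore] -/
theorem init_of_lt {q : Fin (B ℓ np wlen kk)} (hq : (q : ℕ) < ℓ) : init m q = false := by
  unfold init; rw [dif_neg (by omega)]

/-- Above the parameter wires the content is blank. [folklore] -/
theorem init_of_le {q : Fin (B ℓ np wlen kk)} (hq : ℓ + np ≤ (q : ℕ)) : init m q = false := by
  unfold init; rw [dif_neg (by omega)]

/-- The point register is blank. [cite: GroverRudolph2002, eq. (1)] -/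
@[simp] theorem init_ws (j : Fin ℓ) : init m (ws ℓ np wlen kk j) = false :=
  init_of_lt m (by rw [ws_val]; exact j.2)

/-- Off the parameter wires the content is blank. [folklore] -/
theorem init_eq_false_of_not_mem_range {q : Fin (B ℓ np wlen kk)} (hq : q ∉ Set.range (pw ℓ np wlen kk)) :
    init m q = false := by
  unfold init
  split_ifs with h
  · exact absurd ⟨⟨q - ℓ, by omega⟩, Fin.ext (by simp only [pw_val]; omega)⟩ hq
  · rfl

/-- A wire holding `1` initially is a parameter wire whose parameter bit is `1`. [folklore] -/
theorem exists_eq_pw_of_init {q : Fin (B ℓ np wlen kk)} (hq : init m q ≠ false) :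
    ∃ t, pw ℓ np wlen kk t = q ∧ m.c t = true := by
  by_cases h : ℓ ≤ (q : ℕ) ∧ (q : ℕ) < ℓ + np
  · have hpq : pw ℓ np wlen kk ⟨q - ℓ, by omega⟩ = q := Fin.ext (by simp only [pw_val]; omega)
    refine ⟨⟨q - ℓ, by omega⟩, hpq, ?_⟩
    have := init_pw m ⟨q - ℓ, by omega⟩
    rw [hpq] at this
    rw [← this]
    cases hv : init m q
    · exact absurd hv hq
    · rfl
  · exact absurd (by unfold init; rw [dif_neg h]) hq

/-- A parameter wire is not a point wire. [folklore] -/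
theorem pw_not_mem_range_ws (t : Fin np) : pw ℓ np wlen kk t ∉ Set.range (ws ℓ np wlen kk) := by
  rintro ⟨j, h⟩
  have := congrArg Fin.val h
  rw [ws_val, pw_val] at this
  omega

include hk1 in
/-- **The initial content satisfies the block's clean-input condition**: the kit's Hadamard, averaging,
region and helper wires, and every level's work window, all lie at or above `ℓ + np` and are blank;
the parameters are in place. [cite: Regev2009, Lemma 3.12 (proof)] -/
theorem init_mem_P (ha : ∀ j y, |a j y| ≤ 1) (hau : ∀ j y b, a j (Function.update y j b) = a j y) :
    init m ∈ (data m hk1 ha hau).P := by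
  rw [GRBlock.Data.P, Set.mem_inter_iff, Set.mem_inter_iff, Set.mem_iInter, GadgetKit.P, Set.mem_inter_iff,
    mem_cleanOn, mem_cleanOn]
  refine ⟨⟨⟨fun x hx => init_of_le m ?_, fun x hx => init_of_le m ?_⟩, fun j => mem_cleanOn.2 fun x hx => init_of_le m ?_⟩,
    fun t => init_pw m t⟩
  · have := le_of_mem_kit hk1 (List.mem_append_left _ hx); omega
  · have := le_of_mem_kit hk1 (List.mem_append_right _ hx); omega
  · change x ∈ workWires (kit := kit ℓ np wlen kk) m.e m.M (j + np) (m.v j) (ℓ + np) at hx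
    rw [workWires, List.mem_map] at hx
    obtain ⟨w, hw, rfl⟩ := hx
    rw [List.mem_range] at hw
    have htop := top_le m j
    rw [val_finOf_of_lt _ (by unfold B GenKit.bsize GenKit.rb GenKit.dataOff; omega)]
    omega

/-! ### The wires to flip -/

/-- **The wires to flip** to write the parameters into every block from the blank register: the images
`E i (pw t)` of the parameter wires carrying a `1`. [cite: NielsenChuang2010, §4.3] -/
def eraseList {n W : ℕ} (E : Fin n → (Fin (B ℓ np wlen kk) ↪ Fin W)) : List (Fin W) :=
  (List.finRange n).flatMap fun i => ((List.finRange np).filter fun t => m.c t).map fun t => E i (pw ℓ np wlen kk t)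

/-- Membership in the list of wires to flip. [folklore] -/
theorem mem_eraseList_iff' {n W : ℕ} (E : Fin n → (Fin (B ℓ np wlen kk) ↪ Fin W)) (w : Fin W) :
    w ∈ eraseList m E ↔ ∃ i t, m.c t = true ∧ E i (pw ℓ np wlen kk t) = w := by
  simp only [eraseList, List.mem_flatMap, List.mem_finRange, true_and, List.mem_map, List.mem_filter]

/-- **Specification of the wires to flip**: exactly the block images of the non-point wires on which the
initial content differs from the blank label. [cite: Regev2009, Lemma 3.12 (proof)] -/
theorem mem_eraseList_iff {n W : ℕ} (E : Fin n → (Fin (B ℓ np wlen kk) ↪ Fin W)) (w : Fin W) :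
    w ∈ eraseList m E ↔ ∃ i q, q ∉ Set.range (ws ℓ np wlen kk) ∧ init m q ≠ (fun _ => false : QReg (B ℓ np wlen kk)) q ∧ E i q = w := by
  rw [mem_eraseList_iff']
  constructor
  · rintro ⟨i, t, ht, h⟩
    refine ⟨i, pw ℓ np wlen kk t, pw_not_mem_range_ws t, ?_, h⟩
    show init m (pw ℓ np wlen kk t) ≠ false
    rw [init_pw, ht]
    decide
  · rintro ⟨i, q, -, hq, h⟩
    obtain ⟨t, rfl, ht⟩ := exists_eq_pw_of_init m hq
    exact ⟨i, t, ht, h⟩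

/-- **The wires to flip are distinct** when the blocks are pairwise disjoint. [folklore] -/
theorem nodup_eraseList {n W : ℕ} (E : Fin n → (Fin (B ℓ np wlen kk) ↪ Fin W)) (hE : BlockDisjoint E) :
    (eraseList m E).Nodup := by
  rw [eraseList, List.nodup_flatMap]
  refine ⟨fun i _ => (List.Nodup.map (fun t t' h => (pw ℓ np wlen kk).injective ((E i).injective h))
    ((List.nodup_finRange np).filter _)), ?_⟩
  refine List.Pairwise.imp_of_mem (R := (· ≠ ·)) ?_ (List.nodup_finRange n)
  intro i i' _ _ hne
  simp only [Function.onFun, List.disjoint_left, List.mem_map, List.mem_filter]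
  rintro w ⟨t, -, rfl⟩ ⟨t', -, h⟩
  exact Set.disjoint_left.1 (hE i i' hne) ⟨pw ℓ np wlen kk t, rfl⟩ ⟨pw ℓ np wlen kk t', h⟩

end GRData

end Literature.Computability.QuantumComplexity

end
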